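import Literature.MathematicalPhysics.QuantumManyBody.JelliumBoxCutoffs
import Literature.MathematicalPhysics.QuantumManyBody.NeumannMomentumCutoffs
import HarnessLib

/-!
# Lieb–Solovej Lemma 5.1: a simple bound on the number of excited particles in the box

Topic `Literature/MathematicalPhysics/QuantumManyBody` (the charged Bose gas, `JelliumBoseGas.foldyLaw`).
[LiebSolovej2001, Lemma 5.1] ("Simple bound on the number of excited particles"): if
`ω(t)⁻¹ρ^{1/3}ℓ` is large and `⟨H^n_ℓ⟩ ≤ 0` in a state, then the expected number of particles not
in the constant (condensate) mode of the Neumann box satisfies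
`⟨n̂₊⟩ ≤ const · n ρ^{-1/6} (ρ^{1/4}ℓ)²`. Proof: Lemma 4.1 with `r = R = ρ^{-1/3}` (then the cut-off
potential vanishes identically) gives `H^n_ℓ ≥ κ∑(-Δ_{ℓ,j}) - n(½R⁻¹ + const ρr²) = κT - const nρ^{1/3}`,
and the Neumann gap `(u_p, -Δ_ℓ u_p) ≥ π²ℓ⁻²` (`p ≠ 0`) (5.?) gives `T ≥ π²ℓ⁻² ⟨n̂₊⟩`.

In the tree's vocabulary (`boxEnergy κ g ρ θ ν`, Neumann trial states on `Λ_ℓ = (0,ℓ)³`, the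
depletion functional `depletion n ℓ Ψ = ⟨Ψ, n̂₊ Ψ⟩` of `KineticGapLengthScalesAssembly` and the
`N`-body Neumann gap `NeumannBox.gap_mul_nPlusLow_add_mul_nPlusHigh_le`):

* `JelliumBoseGas.cutoffKernel_self`, `boxEnergyK_zero_kernel` — `V_{r,r} = 0` and then
  `⟨Φ, H^n_{ℓ,r,r}Φ⟩ = κ∫|∇Φ|²`;
* `JelliumBoseGas.boxKinetic_le_of_boxEnergy` — `κ∫|∇Φ|² ≤ ⟨Φ,H^n_ℓΦ⟩ + g n(½r⁻¹ + 4πρr²)` for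
  `ν ≤ r⁻¹`;
* `JelliumBoseGas.depletion_le_boxKinetic` — `π²ℓ⁻² ⟨n̂₊⟩ ≤ ∫|∇Φ|²` (the gap);
* `JelliumBoseGas.depletion_le_of_boxEnergy_nonpos` — **Lemma 5.1**: if `⟨Φ, H^n_ℓ Φ⟩ ≤ 0` and
  `ν ≤ ρ^{1/3}` then `⟨n̂₊⟩ ≤ (ℓ/π)² κ⁻¹ g n (½ + 4π) ρ^{1/3}` (`= const n ρ^{-1/6}(ρ^{1/4}ℓ)²`).

## References

* [LiebSolovej2001] E. H. Lieb, J. P. Solovej, Commun. Math. Phys. 217 (2001) 127–163, Lemma 5.1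
  and (5.?) the Neumann gap (arXiv:cond-mat/0007425, p. 11).
-/

noncomputable section

open MeasureTheory Set Filter Real
open scoped ENNReal NNReal Topology

namespace Literature.MathematicalPhysics.QuantumManyBody.JelliumBoseGas

open BoseGas Coulomb NeumannBox
open Literature.Barriers.AtomisticToContinuum.BoseGas (depletion)

variable {n : ℕ} {ℓ : ℝ}

/-! ### The cut-off potential with `r = R` vanishes -/

/-- `V_{r,r} = 0`. [cite: LiebSolovej2001, Lemma 5.1 (proof, "choose r = R")] -/
theorem cutoffKernel_self (r : ℝ) : cutoffKernel r r = fun _ => 0 := by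
  funext x; simp [cutoffKernel]

/-- With the zero kernel all potential terms vanish: `⟨Φ, H Φ⟩ = κ ∫|∇Φ|²`.
[cite: LiebSolovej2001, Lemma 5.1 (proof)] -/
theorem boxEnergyK_zero_kernel (κ g ρ : ℝ) (θ : Space → ℝ) (Φ : NeumannTrialState n ℓ) :
    boxEnergyK κ g ρ (fun _ => 0) θ Φ = κ * (boxKinetic Φ).toReal := by
  have h1 : pairExpectationK (fun _ => (0 : ℝ)) θ Φ = 0 := by
    unfold pairExpectationK pairK
    simp
  have h2 : oneBodyExpectationK (fun _ => (0 : ℝ)) θ Φ = 0 := by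
    unfold oneBodyExpectationK oneBodyK backgroundK
    simp
  have h3 : selfEnergyK (fun _ => (0 : ℝ)) θ = 0 := by
    unfold selfEnergyK backgroundK
    simp
  unfold boxEnergyK
  rw [h1, h2, h3]
  simp

/-- **The kinetic energy is controlled by the energy** [LiebSolovej2001, Lemma 5.1 (proof)]: for
`0 ≤ θ ≤ 1` measurable and integrable, `g, ρ ≥ 0`, `0 < ν ≤ r⁻¹`,
`κ ∫_{Λ^n}|∇Φ|² ≤ ⟨Φ, H^n_ℓ Φ⟩ + g n (½r⁻¹ + 4πρr²)` (Lemma 4.1 with `R = r`, where the cut-off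
potential vanishes). [cite: LiebSolovej2001, Lemma 5.1] -/
theorem boxKinetic_le_of_boxEnergy {κ g ρ : ℝ} (hg : 0 ≤ g) (hρ : 0 ≤ ρ) {θ : Space → ℝ}
    (hθm : Measurable θ) (hθi : Integrable θ) (hθ0 : ∀ x, 0 ≤ θ x) (hθ1 : ∀ x, θ x ≤ 1)
    {ν r : ℝ} (hν : 0 < ν) (hr : 0 < r) (hνr : ν ≤ r⁻¹) (Φ : NeumannTrialState n ℓ) :
    κ * (boxKinetic Φ).toReal ≤ boxEnergy κ g ρ θ ν Φ + g * (n * (1 / 2 * r⁻¹ + 4 * π * ρ * r ^ 2)) := by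
  have h := boxEnergyK_cutoff_le (κ := κ) hg hρ hθm hθi hθ0 hθ1 hν hνr hr le_rfl Φ
  rw [cutoffKernel_self, boxEnergyK_zero_kernel] at h
  linarith

/-! ### The Neumann gap -/

/-- **The Neumann gap for `n` particles** ((5.?) of [LiebSolovej2001]: `(u_p, -Δ_ℓ u_p) ≥ π²ℓ⁻²`
for `p ≠ 0`): `(π/ℓ)² ⟨Ψ, n̂₊ Ψ⟩ ≤ ∫_{Λ_ℓ^n} |∇Ψ|²` for every `C¹` function, with
`⟨Ψ, n̂₊Ψ⟩ = depletion n ℓ Ψ` (the tree's `NeumannBox` gap machinery). [cite: LiebSolovej2001, §5] -/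
theorem depletion_le_boxKinetic (hℓ : 0 < ℓ) (Φ : NeumannTrialState n ℓ) :
    ENNReal.ofReal ((π / ℓ) ^ 2) * depletion n ℓ Φ.ψ ≤ boxKinetic Φ := by
  have h := gap_mul_nPlusLow_add_mul_nPlusHigh_le (K := π) Real.pi_pos.le hℓ Φ.contDiff (N := n)
  rw [← mul_add, ← depletion_eq_nPlusLow_add_nPlusHigh Real.pi_pos.le hℓ Φ.contDiff.continuous] at h
  refine h.trans (le_of_eq ?_)
  rw [boxKinetic, setLIntegral_congr (boxN_ae_eq_cellN n ℓ)]

/-- Real form of the gap: `⟨n̂₊⟩ ≤ (ℓ/π)² ∫|∇Φ|²`. [cite: LiebSolovej2001, §5] -/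
theorem depletion_toReal_le (hℓ : 0 < ℓ) (Φ : NeumannTrialState n ℓ) :
    (depletion n ℓ Φ.ψ).toReal ≤ (ℓ / π) ^ 2 * (boxKinetic Φ).toReal := by
  have hπ : 0 < π := Real.pi_pos
  have hc : 0 < (π / ℓ) ^ 2 := by positivity
  have h := depletion_le_boxKinetic hℓ Φ
  have hK : boxKinetic Φ ≠ ⊤ := boxKinetic_ne_top Φ
  have hD : depletion n ℓ Φ.ψ ≤ ENNReal.ofReal ((ℓ / π) ^ 2) * boxKinetic Φ := by
    have hinv : ENNReal.ofReal ((ℓ / π) ^ 2) * ENNReal.ofReal ((π / ℓ) ^ 2) = 1 := by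
      rw [← ENNReal.ofReal_mul (sq_nonneg _), ← mul_pow, div_mul_div_comm, mul_comm ℓ π,
        div_self (by positivity), one_pow, ENNReal.ofReal_one]
    calc depletion n ℓ Φ.ψ = ENNReal.ofReal ((ℓ / π) ^ 2) * (ENNReal.ofReal ((π / ℓ) ^ 2) * depletion n ℓ Φ.ψ) := by
          rw [← mul_assoc, hinv, one_mul]
      _ ≤ ENNReal.ofReal ((ℓ / π) ^ 2) * boxKinetic Φ := by gcongr
  have h2 := ENNReal.toReal_mono (ENNReal.mul_ne_top ENNReal.ofReal_ne_top hK) hD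
  rwa [ENNReal.toReal_mul, ENNReal.toReal_ofReal (sq_nonneg _)] at h2

/-! ### Lemma 5.1 -/

/-- **[LiebSolovej2001, Lemma 5.1] (simple bound on the number of excited particles)**: let
`0 ≤ θ ≤ 1` be measurable and integrable, `κ > 0`, `g ≥ 0`, `ρ > 0`, `0 < ν ≤ ρ^{1/3}` (i.e.
`R = ρ^{-1/3} ≤ (ω/ℓ)⁻¹`, "allowed since `ω(t)⁻¹ρ^{1/3}ℓ` is large"), `ℓ > 0`, and let `Φ` be a
Neumann trial state of `n` particles in `Λ_ℓ` with `⟨Φ, H^n_ℓ Φ⟩ ≤ 0`. Then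
`⟨Φ, n̂₊ Φ⟩ ≤ (ℓ/π)² κ⁻¹ g n (½ + 4π) ρ^{1/3}` — i.e. `≤ const · n ρ^{-1/6}(ρ^{1/4}ℓ)²` with the
source's `κ = ½γ⁻¹`, `g = 1`. [cite: LiebSolovej2001, Lemma 5.1] -/
theorem depletion_le_of_boxEnergy_nonpos {κ g ρ : ℝ} (hκ : 0 < κ) (hg : 0 ≤ g) (hρ : 0 < ρ)
    {θ : Space → ℝ} (hθm : Measurable θ) (hθi : Integrable θ) (hθ0 : ∀ x, 0 ≤ θ x)
    (hθ1 : ∀ x, θ x ≤ 1) {ν : ℝ} (hν : 0 < ν) (hνρ : ν ≤ ρ ^ (1 / 3 : ℝ)) (hℓ : 0 < ℓ)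
    (Φ : NeumannTrialState n ℓ) (hE : boxEnergy κ g ρ θ ν Φ ≤ 0) :
    (depletion n ℓ Φ.ψ).toReal ≤ (ℓ / π) ^ 2 * (κ⁻¹ * (g * (n * ((1 / 2 + 4 * π) * ρ ^ (1 / 3 : ℝ))))) := by
  -- `r = R = ρ^{-1/3}`
  set r : ℝ := ρ ^ (-(1 / 3 : ℝ)) with hr
  have hrpos : 0 < r := Real.rpow_pos_of_pos hρ _
  have hrinv : r⁻¹ = ρ ^ (1 / 3 : ℝ) := by
    rw [hr, Real.rpow_neg hρ.le, inv_inv]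
  have hρr2 : ρ * r ^ 2 = ρ ^ (1 / 3 : ℝ) := by
    rw [hr, ← Real.rpow_natCast (ρ ^ (-(1 / 3 : ℝ))) 2, ← Real.rpow_mul hρ.le]
    conv_lhs => rw [← Real.rpow_one ρ]
    rw [← Real.rpow_mul hρ.le, ← Real.rpow_add hρ]
    norm_num
  have hkin := boxKinetic_le_of_boxEnergy (κ := κ) hg hρ.le hθm hθi hθ0 hθ1 hν hrpos (by rwa [hrinv]) Φ
  rw [hrinv] at hkin
  have e4 : 4 * π * ρ * r ^ 2 = 4 * π * ρ ^ (1 / 3 : ℝ) := by rw [mul_assoc, hρr2]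
  have hT0 : κ * (boxKinetic Φ).toReal ≤ g * (n * ((1 / 2 + 4 * π) * ρ ^ (1 / 3 : ℝ))) := by
    have e : g * (n * (1 / 2 * ρ ^ (1 / 3 : ℝ) + 4 * π * ρ * r ^ 2)) =
        g * (n * ((1 / 2 + 4 * π) * ρ ^ (1 / 3 : ℝ))) := by
      rw [e4]; ring
    linarith
  have hT : (boxKinetic Φ).toReal ≤ κ⁻¹ * (g * (n * ((1 / 2 + 4 * π) * ρ ^ (1 / 3 : ℝ)))) :=
    (le_inv_mul_iff₀ hκ).2 hT0
  calc (depletion n ℓ Φ.ψ).toReal ≤ (ℓ / π) ^ 2 * (boxKinetic Φ).toReal := depletion_toReal_le hℓ Φ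
    _ ≤ (ℓ / π) ^ 2 * (κ⁻¹ * (g * (n * ((1 / 2 + 4 * π) * ρ ^ (1 / 3 : ℝ))))) :=
        mul_le_mul_of_nonneg_left hT (sq_nonneg _)

end Literature.MathematicalPhysics.QuantumManyBody.JelliumBoseGas
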